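import Summits.BirchSwinnertonDyer.BirchSwinnertonDyer.Theorems.SignedLowerHalvesSmallImageLowerHalfBothSignsRttD2SeqSemilocIncl
import Summits.BirchSwinnertonDyer.BirchSwinnertonDyer.Theorems.SignedLowerHalvesSmallImageLowerHalfBothSignsRttD2SeqJ3HPerf
import Literature.NumberTheory.GaloisRepresentations.DiscreteCochainsLongExact
import HarnessLib

/-!
# Route `SignedLowerHalves`, crux L `SmallImageLowerHalfBothSigns` (stmt-BirchSwinnertonDyer-23599), line `rtt_w3` v30 — stub S3β″ (`stub_junctionPT_ns`), input N5-(i), part 3b (carriers):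
# THE SHORT EXACT SEQUENCE `0 → 𝒪⊗μ_{p^j} → 𝒪⊗μ_{p^{j+1}} → 𝒪⊗μ_p → 0` ON THE COEFFICIENT CARRIERS (injective `oMuIncl`, exact middle, onto `oMuPow`, composite zero)

WIDTH seat `bsd-line-slh-p3-w3` g26 under LEAD `cruxlead-stmt-BirchSwinnertonDyer-23599` g14 (cell `bsd-ssimc`); helper `--supports stmt-BirchSwinnertonDyer-23599`. ONE DEFINITION WITH BODY
(`oMuPow`, the `p^j`-th power map `𝒪 ⊗ μ_{p^{j+1}} → 𝒪 ⊗ μ_p`) + THEOREMS; no named fact, no instance, no `sorry`. HONEST FRAMING: the carrier-level input for discharging hypothesis (E1) of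
`…RttD2SeqSemilocNakayama` (p817289) through the tree's long exact sequence for discrete modules (`IsSES.exists_cohomologyMap_eq_of_cohomologyMap_eq_zero`, next file); pure algebra of
`𝒪 ⊗_ℤ μ_{p^k}(K̄) ≅ 𝒪/p^k`. Nothing about S3β″, crux L or BSD is proved; all remain OPEN and are proved for NO curve.

* `oMuPow` (+`_tmul`, `_muTwistO`, `_zero`, `_succ`); ★ `tmul_eq_zero_iff_dvd` (`b ⊗ ζ₀ = 0 ↔ p^m ∣ b` for a generator `ζ₀`: a functional `𝒪 ⊗ μ_{p^m} → 𝒪/p^m`), `tmul_eq_zero_of_dvd`;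
  `muInclusion_injective`, `muInclusion_muPowMap_eq_nsmul`, `card_nsmul_muCarrier`, ★ `generator_muPowMap` (generators descend along power maps), `muPowMap_surjective_of_generator`,
  `exists_map_muPowMap_eq`; ★ `oMuPow_oMuIncl` (= 0), ★ `oMuIncl_injective`, ★ `exists_oMuIncl_eq_of_oMuPow_eq_zero` (exact middle), ★ `oMuPow_surjective`.
References: [NeukirchSchmidtWingberg2008] (7.1.4), (7.2.6); [SerreLocalFields1979] IV §4; [Kato2004Asterisque] §8.2 (p. 180).
-/

set_option autoImplicit false
set_option linter.dupNamespace false -- D-0017: single-problem summit, the namespace repeats the problem name by design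
noncomputable section

open scoped Classical TensorProduct
open NumberField IsDedekindDomain Field CategoryTheory Function

namespace Summit.BirchSwinnertonDyer.BirchSwinnertonDyer.Theorems.SmallImageRttD2Seq

open Literature.NumberTheory.EllipticCurves Literature.NumberTheory.GaloisRepresentations Literature.NumberTheory.GaloisRepresentations.DiscreteGaloisModule
  Literature.NumberTheory.ComplexMultiplication.EllipticUnits.JohnsonLeungKings2011
  Summit.BirchSwinnertonDyer.BirchSwinnertonDyer.Theorems.SmallImageRttD2J1

/-! ## §1. The coefficient short exact sequence on carriers -/

section Carrier

variable {K : Type} [Field K] [NumberField K] {p : ℕ} [Fact p.Prime] (S : Set (PadicAlgCl p)) (θ' : absoluteGaloisGroup K →ₜ* (padicCoeffIntegers S)ˣ)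

/-- **The `p^j`-th power map `𝒪 ⊗ μ_{p^{j+1}} → 𝒪 ⊗ μ_p`, `a ⊗ ζ ↦ a ⊗ ζ^{p^j}`** (`id ⊗ muPowMap`); under `𝒪 ⊗ μ_{p^k} ≅ 𝒪/p^k` it is reduction modulo `p`.
[cite: Kato2004Asterisque, §8.2 (p. 180)] [cite: NeukirchSchmidtWingberg2008, (7.2.6)] -/
def oMuPow (j : ℕ) : OMuCarrier K S (p ^ (j + 1)) →+ OMuCarrier K S (p ^ 1) :=
  (TensorProduct.map (LinearMap.id : padicCoeffIntegers S →ₗ[ℤ] padicCoeffIntegers S)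
    (muPowMap K (pow_dvd_pow p (Nat.succ_le_succ (Nat.zero_le j)))).toIntLinearMap).toAddMonoidHom

omit [NumberField K] in
/-- `oMuPow` on pure tensors. [folklore] -/
@[simp] theorem oMuPow_tmul (j : ℕ) (a : padicCoeffIntegers S) (v : MuCarrier K (p ^ (j + 1))) :
    oMuPow S j (OMuCarrier.tmul (K := K) a v) = OMuCarrier.tmul a (muPowMap K (pow_dvd_pow p (Nat.succ_le_succ (Nat.zero_le j))) v) :=
  rfl

omit [NumberField K] [Fact p.Prime] in
/-- `ζ ↦ ζ^{m/n}` is `Γ_K`-equivariant. [folklore] -/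
theorem muPowMap_mu {n m : ℕ} (h : n ∣ m) (σ : absoluteGaloisGroup K) (v : MuCarrier K m) :
    muPowMap K h (mu K m σ v) = mu K n σ (muPowMap K h v) := by
  apply muVal_injective K n
  rw [muVal_muPowMap, muVal_apply, muVal_apply, muVal_muPowMap, smul_pow']

omit [NumberField K] in
/-- `oMuPow` is `Γ_K`-equivariant for the `θ′`-twisted actions. [cite: NeukirchSchmidtWingberg2008, (7.2.6)] -/
theorem oMuPow_muTwistO (j : ℕ) (σ : absoluteGaloisGroup K) (x : OMuCarrier K S (p ^ (j + 1))) :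
    oMuPow S j (muTwistO S θ' (j + 1) σ x) = muTwistO S θ' 1 σ (oMuPow S j x) := by
  induction x using OMuCarrier.induction_on with
  | zero => simp
  | tmul a v => rw [muTwistO_tmul, oMuPow_tmul, oMuPow_tmul, muTwistO_tmul, muPowMap_mu]
  | add x y hx hy => rw [map_add, map_add, hx, hy, map_add, map_add]

omit [NumberField K] in
/-- `oMuPow 0 = id` (`ζ ↦ ζ^{1}`). [folklore] -/
theorem oMuPow_zero (x : OMuCarrier K S (p ^ (0 + 1))) : oMuPow S 0 x = x := by
  induction x using OMuCarrier.induction_on with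
  | zero => simp
  | tmul a v =>
    rw [oMuPow_tmul]
    congr 1
    apply muVal_injective K (p ^ 1)
    rw [muVal_muPowMap, Nat.div_self (pow_pos (Fact.out : p.Prime).pos _), pow_one]
  | add x y hx hy => rw [map_add, hx, hy]

omit [NumberField K] in
/-- `oMuPow (j+1) = oMuPow j ∘ red` (`ζ^{p^{j+1}} = (ζ^p)^{p^j}`). [folklore] -/
theorem oMuPow_succ (j : ℕ) (x : OMuCarrier K S (p ^ (j + 1 + 1))) : oMuPow S (j + 1) x = oMuPow S j (oMuRed S (j + 1) x) := by
  induction x using OMuCarrier.induction_on with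
  | zero => simp
  | tmul a v =>
    rw [oMuPow_tmul, oMuRed_tmul, oMuPow_tmul]
    congr 1
    apply muVal_injective K (p ^ 1)
    have hp : 0 < p := (Fact.out : p.Prime).pos
    rw [muVal_muPowMap, muVal_muPowMap, muVal_muPowMap, ← pow_mul, Nat.pow_div (Nat.succ_le_succ (Nat.zero_le (j + 1))) hp,
      Nat.pow_div (Nat.le_succ (j + 1)) hp, Nat.pow_div (Nat.succ_le_succ (Nat.zero_le j)) hp, ← pow_add]
    congr 2
    omega
  | add x y hx hy => rw [map_add, hx, hy, map_add, map_add]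

omit [NumberField K] in
/-- ★ **`b ⊗ ζ₀ = 0 ↔ p^m ∣ b`** in `𝒪 ⊗_ℤ μ_{p^m}(K̄)` for a generator `ζ₀` of exact order `p^m` (`e ζ₀ = 1` for `e : μ_{p^m} ≃ ℤ/p^m`): the functional `a ⊗ ζ ↦ e(ζ)·a mod p^m` to `𝒪/p^m`
detects `b`. (`𝒪 ⊗ μ_{p^m} ≅ 𝒪/p^m`.) [cite: NeukirchSchmidtWingberg2008, (7.2.6)] [folklore] -/
theorem tmul_eq_zero_iff_dvd (m : ℕ) {e : MuCarrier K (p ^ m) ≃+ ZMod (p ^ m)} {ζ₀ : MuCarrier K (p ^ m)} (he : e ζ₀ = 1)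
    (hord : ∀ k : ℤ, k • ζ₀ = 0 ↔ ((p ^ m : ℕ) : ℤ) ∣ k) (b : padicCoeffIntegers S) :
    OMuCarrier.tmul (K := K) b ζ₀ = 0 ↔ ((p : padicCoeffIntegers S) ^ m) ∣ b := by
  constructor
  · intro hb
    -- the functional `a ⊗ ζ ↦ e(ζ) · (a mod p^m)` to `𝒪/p^m`
    let I : Ideal (padicCoeffIntegers S) := Ideal.span {(p : padicCoeffIntegers S) ^ m}
    have hfn : ∀ a : padicCoeffIntegers S, zmultiplesHom (padicCoeffIntegers S ⧸ I) (Ideal.Quotient.mk I a) ((p ^ m : ℕ) : ℤ) = 0 := fun a ↦ by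
      change ((p ^ m : ℕ) : ℤ) • Ideal.Quotient.mk I a = 0
      rw [natCast_zsmul, ← map_nsmul, nsmul_eq_mul, Ideal.Quotient.eq_zero_iff_mem]
      exact Ideal.mem_span_singleton'.mpr ⟨a, by rw [Nat.cast_pow, mul_comm]⟩
    let F : padicCoeffIntegers S →+ MuCarrier K (p ^ m) →+ padicCoeffIntegers S ⧸ I :=
      { toFun := fun a ↦ (ZMod.lift (p ^ m) ⟨zmultiplesHom (padicCoeffIntegers S ⧸ I) (Ideal.Quotient.mk I a), hfn a⟩).comp e.toAddMonoidHom
        map_zero' := by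
          apply AddMonoidHom.ext; intro ζ
          obtain ⟨z, hz⟩ := ZMod.intCast_surjective (e ζ)
          change ZMod.lift (p ^ m) ⟨zmultiplesHom (padicCoeffIntegers S ⧸ I) (Ideal.Quotient.mk I 0), hfn 0⟩ (e ζ) = 0
          rw [← hz, ZMod.lift_coe]
          change z • Ideal.Quotient.mk I 0 = 0
          rw [map_zero, zsmul_zero]
        map_add' := fun a a' ↦ by
          apply AddMonoidHom.ext; intro ζ
          obtain ⟨z, hz⟩ := ZMod.intCast_surjective (e ζ)
          change ZMod.lift (p ^ m) ⟨zmultiplesHom (padicCoeffIntegers S ⧸ I) (Ideal.Quotient.mk I (a + a')), hfn (a + a')⟩ (e ζ) =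
            ZMod.lift (p ^ m) ⟨zmultiplesHom (padicCoeffIntegers S ⧸ I) (Ideal.Quotient.mk I a), hfn a⟩ (e ζ) +
              ZMod.lift (p ^ m) ⟨zmultiplesHom (padicCoeffIntegers S ⧸ I) (Ideal.Quotient.mk I a'), hfn a'⟩ (e ζ)
          rw [← hz, ZMod.lift_coe, ZMod.lift_coe, ZMod.lift_coe]
          change z • Ideal.Quotient.mk I (a + a') = z • Ideal.Quotient.mk I a + z • Ideal.Quotient.mk I a'
          rw [map_add, zsmul_add] }
    have hF : ∀ (a : padicCoeffIntegers S) (ζ : MuCarrier K (p ^ m)) (z : ℤ), (z : ZMod (p ^ m)) = e ζ → F a ζ = z • Ideal.Quotient.mk I a := fun a ζ z hz ↦ by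
      change ZMod.lift (p ^ m) ⟨zmultiplesHom (padicCoeffIntegers S ⧸ I) (Ideal.Quotient.mk I a), hfn a⟩ (e ζ) = _
      rw [← hz, ZMod.lift_coe]
      rfl
    have hcompat : ∀ (r : ℤ) (a : padicCoeffIntegers S) (ζ : MuCarrier K (p ^ m)), F (r • a) ζ = F a (r • ζ) := fun r a ζ ↦ by
      obtain ⟨z, hz⟩ := ZMod.intCast_surjective (e ζ)
      have hz' : ((z * r : ℤ) : ZMod (p ^ m)) = e (r • ζ) := by rw [map_zsmul, ← hz, zsmul_eq_mul, Int.cast_mul, mul_comm]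
      rw [hF (r • a) ζ z hz, hF a (r • ζ) (z * r) hz', map_zsmul, smul_smul]
    let Φ : OMuCarrier K S (p ^ m) →+ padicCoeffIntegers S ⧸ I := (TensorProduct.liftAddHom F hcompat).comp OMuCarrier.toTensor.toAddMonoidHom
    have hΦ : Φ (OMuCarrier.tmul b ζ₀) = Ideal.Quotient.mk I b := by
      change TensorProduct.liftAddHom F hcompat (b ⊗ₜ[ℤ] ζ₀) = _
      rw [TensorProduct.liftAddHom_tmul, hF b ζ₀ 1 (by rw [Int.cast_one, he]), one_zsmul]
    have h0 : Ideal.Quotient.mk I b = 0 := by rw [← hΦ, hb, map_zero]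
    exact Ideal.mem_span_singleton.mp (Ideal.Quotient.eq_zero_iff_mem.mp h0)
  · rintro ⟨c, rfl⟩
    rw [mul_comm, ← Nat.cast_pow, ← nsmul_eq_mul', ← natCast_zsmul]
    change OMuCarrier.toTensor.symm ((((p ^ m : ℕ) : ℤ) • c) ⊗ₜ[ℤ] ζ₀) = 0
    rw [TensorProduct.smul_tmul, (hord _).mpr (dvd_refl _), TensorProduct.tmul_zero, map_zero]

omit [NumberField K] in
/-- `b ⊗ ζ₀ = 0` when `p^m ∣ b`, for any `ζ₀ ∈ μ_{p^m}` killed exactly by the multiples of `p^m` (only `p^m • ζ₀ = 0` is used). [folklore] -/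
theorem tmul_eq_zero_of_dvd {m : ℕ} {ζ₀ : MuCarrier K (p ^ m)} (hord : ∀ k : ℤ, k • ζ₀ = 0 ↔ ((p ^ m : ℕ) : ℤ) ∣ k) {b : padicCoeffIntegers S}
    (hb : ((p : padicCoeffIntegers S) ^ m) ∣ b) : OMuCarrier.tmul (K := K) b ζ₀ = 0 := by
  obtain ⟨c, rfl⟩ := hb
  rw [mul_comm, ← Nat.cast_pow, ← nsmul_eq_mul', ← natCast_zsmul]
  change OMuCarrier.toTensor.symm ((((p ^ m : ℕ) : ℤ) • c) ⊗ₜ[ℤ] ζ₀) = 0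
  rw [TensorProduct.smul_tmul, (hord _).mpr (dvd_refl _), TensorProduct.tmul_zero, map_zero]

omit [NumberField K] [Fact p.Prime] in
/-- `μ_d ⊆ μ_N` is injective. [folklore] -/
theorem muInclusion_injective {d N : ℕ} (h : d ∣ N) : Function.Injective (muInclusion K h) := fun a b hab ↦
  muVal_injective K d (by rw [← muVal_muInclusion K h a, hab, muVal_muInclusion])

omit [NumberField K] [Fact p.Prime] in
/-- `incl (ζ^{N/d}) = (N/d)·ζ` for `ζ ∈ μ_N`. [folklore] -/
theorem muInclusion_muPowMap_eq_nsmul {d N : ℕ} (h : d ∣ N) (ζ : MuCarrier K N) : muInclusion K h (muPowMap K h ζ) = (N / d) • ζ :=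
  muVal_injective K N (by rw [muVal_muInclusion, muVal_muPowMap, muVal_nsmul])

omit [NumberField K] [Fact p.Prime] in
/-- `d • ζ = 0` in `μ_d`. [folklore] -/
theorem card_nsmul_muCarrier {d : ℕ} (ζ : MuCarrier K d) : d • ζ = 0 :=
  muVal_injective K d (by rw [muVal_nsmul, muVal_pow_eq_one, muVal_zero])

omit [NumberField K] [Fact p.Prime] in
/-- ★ **Generators descend along the power maps**: if `ζ₀` generates `μ_N` with `k • ζ₀ = 0 ↔ N ∣ k`, then `ζ₀^{N/d}` generates `μ_d` with `k • ζ₀^{N/d} = 0 ↔ d ∣ k` (`d ∣ N`, `d ≠ 0`).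
[cite: SerreLocalFields1979, IV §4] [folklore] -/
theorem generator_muPowMap {d N : ℕ} (h : d ∣ N) (hd : d ≠ 0) (hN : N ≠ 0) {ζ₀ : MuCarrier K N} (hgen : ∀ ζ : MuCarrier K N, ∃ k : ℤ, ζ = k • ζ₀)
    (hord : ∀ k : ℤ, k • ζ₀ = 0 ↔ (N : ℤ) ∣ k) :
    (∀ ζ : MuCarrier K d, ∃ k : ℤ, ζ = k • muPowMap K h ζ₀) ∧ ∀ k : ℤ, k • muPowMap K h ζ₀ = 0 ↔ (d : ℤ) ∣ k := by
  obtain ⟨q, hq⟩ := id h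
  have hq0 : q ≠ 0 := by
    rintro rfl
    rw [mul_zero] at hq
    exact hN hq
  have hNd : N / d = q := by rw [hq, Nat.mul_div_cancel_left q (Nat.pos_of_ne_zero hd)]
  have hincl : muInclusion K h (muPowMap K h ζ₀) = (q : ℤ) • ζ₀ := by rw [muInclusion_muPowMap_eq_nsmul, hNd, natCast_zsmul]
  refine ⟨fun ζ ↦ ?_, fun k ↦ ?_⟩
  · obtain ⟨k', hk'⟩ := hgen (muInclusion K h ζ)
    have hkill : ((d : ℤ) * k') • ζ₀ = 0 := by
      rw [← smul_smul, ← hk', ← map_zsmul, natCast_zsmul, card_nsmul_muCarrier, map_zero]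
    obtain ⟨k, rfl⟩ : (q : ℤ) ∣ k' := by
      have hdvd := (hord _).mp hkill
      rw [hq, Nat.cast_mul] at hdvd
      exact (mul_dvd_mul_iff_left (by exact_mod_cast hd : (d : ℤ) ≠ 0)).mp hdvd
    refine ⟨k, muInclusion_injective (K := K) h ?_⟩
    rw [hk', map_zsmul, hincl, smul_smul, mul_comm]
  · constructor
    · intro hk
      have h1 : (k * q : ℤ) • ζ₀ = 0 := by rw [← smul_smul, ← hincl, ← map_zsmul, hk, map_zero]
      have hdvd := (hord _).mp h1
      rw [hq, Nat.cast_mul] at hdvd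
      exact (mul_dvd_mul_iff_right (by exact_mod_cast hq0 : (q : ℤ) ≠ 0)).mp hdvd
    · rintro ⟨c, rfl⟩
      rw [mul_comm, ← smul_smul, natCast_zsmul, card_nsmul_muCarrier, smul_zero]

omit [NumberField K] [Fact p.Prime] in
/-- The power maps `μ_N → μ_d` are onto (generators descend). [folklore] -/
theorem muPowMap_surjective_of_generator {d N : ℕ} (h : d ∣ N) (hd : d ≠ 0) (hN : N ≠ 0) {ζ₀ : MuCarrier K N} (hgen : ∀ ζ : MuCarrier K N, ∃ k : ℤ, ζ = k • ζ₀)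
    (hord : ∀ k : ℤ, k • ζ₀ = 0 ↔ (N : ℤ) ∣ k) : Function.Surjective (muPowMap K h) := fun ζ ↦ by
  obtain ⟨k, rfl⟩ := (generator_muPowMap (K := K) h hd hN hgen hord).1 ζ
  exact ⟨k • ζ₀, map_zsmul _ _ _⟩

omit [NumberField K] in
/-- Every element of `𝒪 ⊗ μ_d` is `red(x)` for the reduction along an onto power map. [folklore] -/
theorem exists_map_muPowMap_eq {d N : ℕ} (h : d ∣ N) (hsurj : Function.Surjective (muPowMap K h)) (y : OMuCarrier K S d) :
    ∃ x : OMuCarrier K S N, (TensorProduct.map (LinearMap.id : padicCoeffIntegers S →ₗ[ℤ] padicCoeffIntegers S) (muPowMap K h).toIntLinearMap).toAddMonoidHom x = y := by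
  induction y using OMuCarrier.induction_on with
  | zero => exact ⟨0, map_zero _⟩
  | tmul a v =>
    obtain ⟨u, rfl⟩ := hsurj v
    exact ⟨OMuCarrier.tmul a u, rfl⟩
  | add y z hy hz =>
    obtain ⟨x, rfl⟩ := hy
    obtain ⟨x', rfl⟩ := hz
    exact ⟨x + x', map_add _ _ _⟩

omit [NumberField K] in
/-- ★ **`oMuPow ∘ oMuIncl = 0`** (`(ζ)^{p^j} = 1` for `ζ ∈ μ_{p^j}`). [cite: NeukirchSchmidtWingberg2008, (7.2.6)] -/
theorem oMuPow_oMuIncl (j : ℕ) (x : OMuCarrier K S (p ^ j)) : oMuPow S j (oMuIncl S j x) = 0 := by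
  induction x using OMuCarrier.induction_on with
  | zero => simp
  | tmul a v =>
    rw [oMuIncl_tmul, oMuPow_tmul]
    have hv : muPowMap K (pow_dvd_pow p (Nat.succ_le_succ (Nat.zero_le j))) (muInclusion K (pow_dvd_pow p (Nat.le_succ j)) v) = 0 := by
      apply muVal_injective K (p ^ 1)
      rw [muVal_muPowMap, muVal_muInclusion, muVal_zero, pow_one, pow_succ, Nat.mul_div_cancel _ (Fact.out : p.Prime).pos, muVal_pow_eq_one]
    rw [hv]
    change OMuCarrier.toTensor.symm (a ⊗ₜ[ℤ] (0 : MuCarrier K (p ^ 1))) = 0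
    rw [TensorProduct.tmul_zero, map_zero]
  | add x y hx hy => rw [map_add, map_add, hx, hy, add_zero]

/-- ★ **`oMuIncl` is injective** (`c ⊗ ζ₀^p ↦ pc ⊗ ζ₀`, and `pc ⊗ ζ₀ = 0 ⇒ p^{j+1} ∣ pc ⇒ p^j ∣ c ⇒ c ⊗ ζ₀^p = 0`). [cite: NeukirchSchmidtWingberg2008, (7.1.4)] -/
theorem oMuIncl_injective (j : ℕ) : Function.Injective (oMuIncl (K := K) S j) := by
  obtain ⟨e, ζ₀, he1, hgen, hord⟩ := exists_generator_muCarrier K (p := p) (j + 1)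
  have hgen' : ∀ ζ : MuCarrier K (p ^ (j + 1)), ∃ k : ℤ, ζ = k • ζ₀ := fun ζ ↦ ⟨_, hgen ζ⟩
  have hdesc := generator_muPowMap (K := K) (pow_dvd_pow p (Nat.le_succ j)) (pow_ne_zero _ (Fact.out : p.Prime).ne_zero) (pow_ne_zero _ (Fact.out : p.Prime).ne_zero)
    hgen' (fun k ↦ by rw [hord k, Nat.cast_pow])
  rw [injective_iff_map_eq_zero]
  intro x hx
  obtain ⟨x', rfl⟩ := exists_map_muPowMap_eq S (pow_dvd_pow p (Nat.le_succ j))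
    (muPowMap_surjective_of_generator (K := K) _ (pow_ne_zero _ (Fact.out : p.Prime).ne_zero) (pow_ne_zero _ (Fact.out : p.Prime).ne_zero) hgen'
      (fun k ↦ by rw [hord k, Nat.cast_pow])) x
  obtain ⟨b, rfl⟩ := exists_eq_tmul_of_generator K S (j + 1) hgen' x'
  -- `x = b ⊗ ζ₀^p`, `incl x = p b ⊗ ζ₀`
  change oMuIncl S j (oMuRed S j (OMuCarrier.tmul b ζ₀)) = 0 at hx
  change oMuRed S j (OMuCarrier.tmul b ζ₀) = 0
  rw [oMuIncl_oMuRed, oMuScalar_tmul, tmul_eq_zero_iff_dvd S (j + 1) he1 hord] at hx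
  rw [oMuRed_tmul]
  refine tmul_eq_zero_of_dvd S (fun k ↦ by rw [hdesc.2 k, Nat.cast_pow]) ?_
  rw [pow_succ'] at hx
  exact (mul_dvd_mul_iff_left (by exact_mod_cast (Fact.out : p.Prime).ne_zero : (p : padicCoeffIntegers S) ≠ 0)).mp hx

/-- ★ **`ker oMuPow ⊆ im oMuIncl`** (exactness of `0 → 𝒪⊗μ_{p^j} → 𝒪⊗μ_{p^{j+1}} → 𝒪⊗μ_p → 0` in the middle): `b ⊗ ζ₀ ↦ b ⊗ ζ₀^{p^j} = 0 ⇒ p ∣ b ⇒ b ⊗ ζ₀ = incl(b/p ⊗ ζ₀^p)`.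
[cite: NeukirchSchmidtWingberg2008, (7.2.6)] -/
theorem exists_oMuIncl_eq_of_oMuPow_eq_zero (j : ℕ) (x : OMuCarrier K S (p ^ (j + 1))) (hx : oMuPow S j x = 0) : ∃ y, oMuIncl S j y = x := by
  obtain ⟨e, ζ₀, he1, hgen, hord⟩ := exists_generator_muCarrier K (p := p) (j + 1)
  have hgen' : ∀ ζ : MuCarrier K (p ^ (j + 1)), ∃ k : ℤ, ζ = k • ζ₀ := fun ζ ↦ ⟨_, hgen ζ⟩
  obtain ⟨b, rfl⟩ := exists_eq_tmul_of_generator K S (j + 1) hgen' x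
  -- apply the inclusion `𝒪 ⊗ μ_p → 𝒪 ⊗ μ_{p^{j+1}}`: `b ⊗ incl(ζ₀^{p^j}) = p^j b ⊗ ζ₀ = 0`
  have hp0 : 0 < p := (Fact.out : p.Prime).pos
  have h1 : OMuCarrier.tmul (K := K) (((p : ℕ) : padicCoeffIntegers S) ^ j * b) ζ₀ = 0 := by
    have h : (TensorProduct.map (LinearMap.id : padicCoeffIntegers S →ₗ[ℤ] padicCoeffIntegers S)
        (muInclusion K (pow_dvd_pow p (Nat.succ_le_succ (Nat.zero_le j)))).toIntLinearMap).toAddMonoidHom (oMuPow S j (OMuCarrier.tmul b ζ₀)) = 0 := by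
      rw [hx]; exact map_zero _
    rw [oMuPow_tmul] at h
    change OMuCarrier.tmul b (muInclusion K (pow_dvd_pow p (Nat.succ_le_succ (Nat.zero_le j))) (muPowMap K (pow_dvd_pow p (Nat.succ_le_succ (Nat.zero_le j))) ζ₀)) = 0 at h
    have hq : p ^ (j + 1) / p = p ^ j := by rw [pow_succ, Nat.mul_div_cancel _ hp0]
    rw [muInclusion_muPowMap_eq_nsmul, pow_one, hq, ← natCast_zsmul, tmul_zsmul_eq K S, zsmul_eq_mul, Int.cast_natCast, Nat.cast_pow] at h
    exact h
  rw [tmul_eq_zero_iff_dvd S (j + 1) he1 hord, pow_succ, mul_dvd_mul_iff_left (pow_ne_zero _ (by exact_mod_cast hp0.ne' : (p : padicCoeffIntegers S) ≠ 0))] at h1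
  obtain ⟨b', rfl⟩ := h1
  refine ⟨oMuRed S j (OMuCarrier.tmul b' ζ₀), ?_⟩
  rw [oMuIncl_oMuRed, oMuScalar_tmul]

/-- ★ **`oMuPow` is onto** (`ζ₀^{p^j}` generates `μ_p`). [cite: NeukirchSchmidtWingberg2008, (7.2.6)] -/
theorem oMuPow_surjective (j : ℕ) : Function.Surjective (oMuPow (K := K) S j) := by
  obtain ⟨e, ζ₀, -, hgen, hord⟩ := exists_generator_muCarrier K (p := p) (j + 1)
  have hgen' : ∀ ζ : MuCarrier K (p ^ (j + 1)), ∃ k : ℤ, ζ = k • ζ₀ := fun ζ ↦ ⟨_, hgen ζ⟩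
  exact exists_map_muPowMap_eq S _ (muPowMap_surjective_of_generator (K := K) _ (pow_ne_zero _ (Fact.out : p.Prime).ne_zero)
    (pow_ne_zero _ (Fact.out : p.Prime).ne_zero) hgen' (fun k ↦ by rw [hord k, Nat.cast_pow]))

end Carrier

end Summit.BirchSwinnertonDyer.BirchSwinnertonDyer.Theorems.SmallImageRttD2Seq

end
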